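import Summits.RiemannHypothesis.RiemannHypothesis.Theorems.WeilFormatCCinfVTableCoeffBox
import Summits.RiemannHypothesis.RiemannHypothesis.Theorems.WeilFormatCCinfVTable
import Literature.NumberTheory.LFunctions.YoshidaWindowGramColumnData
import HarnessLib

/-!
# Format C, design C∞ (E2, data side): the PROFILE-TABLE primitive — entry boxes of `V⁺_j(m)`, `V⁻_j(k)` and their packed claims

Route context: Fourier–Galerkin / Schur-complement certificates of Weil positivity on a window ("format C", C∞ door
`weilPositivityOn_of_cinf_cert`, `WeilFormatCCinfDoorCert`; supporting stmt-RiemannHypothesis-0098; seat rh-explicit-weil-2,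
cell memos `…/rh-explicit-weil-2/gen16/E2F-CERT-PIPELINE.md` §2 (primitives FL/FM/FMT, V-table) and `E2F-EMITTER-SPEC.md` §5).

The exact-integer stages consume the door's profile tables
`V⁺_j(m) = d_m² Re ĉ_m(1_{[-a,a]} f_j)/√(2a)` (`d_0² = 1`, `d_m² = 2`), `V⁻_j(k) = 2 Im ĉ_{k+1}(1 f_j)/√(2a)`, `f_j = Σ_q c_{jq} x^q`,
as CLAIMED packed tables.  From the landed closed forms (`evenVTable_zero` of `WeilFormatCCinfLowTable`, repeated here as a
`private` local copy because that module has no farm olean at filing time; `evenVTable_collected`,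
`oddVTable_collected` of `WeilFormatCCinfVTable`) and the landed coefficient boxes (`CinfCoeff.evenVTabBox/oddVTabBox`,
`WeilFormatCCinfVTableCoeffBox`: `RV^±(d) ∋ box`, inputs `AP ∋ a/π`, `Rs ∋ 1/√(2a)`):

* `CinfPrimV.zeroSumQ` / `evenVBox` / `oddVBox` — per-entry interval evaluators (`m = 0`: the rational `Σ_q c_q (a^{q+1} − (−a)^{q+1})/(q+1)`
  times `Rs`; `m ≠ 0`: `(−1)^m Σ_{d≤D} RV⁺(d)/m^d`; odd: mode `k+1`);
* ★ `mem_evenVBox`, ★ `mem_oddVBox` — they enclose the door's PRINTED profile-table entries (coefficients `((c_{jq} : ℚ) : ℝ)`,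
  powers `s = sl.toFinset`, `q + 1 ≤ D` on `sl`);
* `dataNear_of_checkRect` — any evaluator + one passing `Encl.checkRect` over the full rectangle ⇒ `Encl.DataNear` (then
  `CinfPacked.TabNear.of_dataNear`, `WeilFormatCCinfCertPacked`); ★ `vDataNear_even/odd` — the packed claims of the tables
  `(j, t) ↦ V^±_j(m₀ + t)` (rows `j < r`; `m₀ = 0`: low table, `m₀ = B`: middle modes), ★ `vDataNearT_even/odd` — the TRANSPOSED
  layout `(t, j)` the stage-L pairs read (`CinfColE.FMT`).

Bookkeeping over landed evaluators; standard axioms; no RH claim.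
-/

set_option autoImplicit false
-- `Summit.RiemannHypothesis.RiemannHypothesis.…` is the layout-mandated namespace (summit = problem name).
set_option linter.dupNamespace false

open Complex Set Finset
open scoped Real

namespace Summit.RiemannHypothesis.RiemannHypothesis.Theorems.WeilFormatC

namespace CinfPrimV

open Literature.NumberTheory.LFunctions Literature.NumberTheory.LFunctions.Yoshida1992
open Literature.Analysis.ValidatedNumerics Literature.Analysis.ValidatedNumerics.NumericsMP
open WinConst (mulRatBox mem_mulRatBox)
open WinEntry (sumBox mem_sumBox)
open CinfCoeff (evenVTabBox oddVTabBox mem_evenVTabBox mem_oddVTabBox)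

variable {S : ℕ}

/-! ## The entry evaluators -/

/-- The rational `Σ_{q ∈ sl} c_q (a^{q+1} − (−a)^{q+1})/(q+1)` (`√(2a) · V⁺(0)`). -/
def zeroSumQ (c : ℕ → ℚ) (a : ℚ) (sl : List ℕ) : ℚ :=
  (sl.map fun q ↦ c q * ((a ^ (q + 1) - (-a) ^ (q + 1)) / (q + 1))).sum

/-- **Even profile-table entry box** at mode `m`: `m = 0`: `zeroSumQ · Rs`; `m ≠ 0`: `(−1)^m Σ_{d≤D} RV⁺(d)/m^d`. -/
def evenVBox (S : ℕ) (AP Rs : MI) (c : ℕ → ℚ) (a : ℚ) (sl : List ℕ) (D m : ℕ) : MI :=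
  if m = 0 then mulRatBox Rs (zeroSumQ c a sl)
  else (sumBox S (fun d ↦ (evenVTabBox S AP Rs c a sl d).divNat (m ^ d)) (D + 1)).mulInt ((-1) ^ m)

/-- **Odd profile-table entry box** at kernel index `k` (mode `k + 1`): `(−1)^{k+1} Σ_{d≤D} RV⁻(d)/(k+1)^d`. -/
def oddVBox (S : ℕ) (AP Rs : MI) (c : ℕ → ℚ) (a : ℚ) (sl : List ℕ) (D k : ℕ) : MI :=
  (sumBox S (fun d ↦ (oddVTabBox S AP Rs c a sl d).divNat ((k + 1) ^ d)) (D + 1)).mulInt ((-1) ^ (k + 1))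

/-! ## Local copies (`WeilFormatCCinfLowTable` has no farm olean at filing time) -/

/-- Local copy of `fourierCoeff_zero_pow` (`WeilFormatCCinfLowTable`): `ĉ_0(x^q) = (a^{q+1} − (−a)^{q+1})/(q+1)`. -/
private theorem fourierCoeff_zero_pow_loc (a : ℝ) (q : ℕ) :
    Yoshida1992.fourierCoeff a 0 (fun x : ℝ ↦ ((x : ℂ)) ^ q)
      = ((((a ^ (q + 1) - (-a) ^ (q + 1)) / (q + 1) : ℝ)) : ℂ) := by
  unfold Yoshida1992.fourierCoeff
  have e : (fun x : ℝ ↦ ((x : ℂ)) ^ q * cexp (-(π * I * ((0 : ℤ) : ℂ) * x / a)))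
      = fun x : ℝ ↦ (((x ^ q : ℝ)) : ℂ) := by
    funext x
    simp only [Int.cast_zero, mul_zero, zero_mul, zero_div, neg_zero, Complex.exp_zero, mul_one,
      Complex.ofReal_pow]
  rw [e, intervalIntegral.integral_ofReal, integral_pow]

/-- Local copy of `evenVTable_zero` (`WeilFormatCCinfLowTable`): the even table at the constant mode. -/
private theorem evenVTable_zero_loc {a : ℝ} (ha : 0 ≤ a) (s : Finset ℕ) (c : ℕ → ℝ) :
    (if (0 : ℕ) = 0 then (1 : ℝ) else 2) * (Yoshida1992.fourierCoeff a (0 : ℕ)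
        ((Icc (-a) a).indicator fun x : ℝ ↦ ∑ q ∈ s, ((c q : ℝ) : ℂ) * ((x : ℂ)) ^ q)).re / Real.sqrt (2 * a)
      = (∑ q ∈ s, c q * ((a ^ (q + 1) - (-a) ^ (q + 1)) / (q + 1))) / Real.sqrt (2 * a) := by
  rw [if_pos rfl, one_mul, Nat.cast_zero, fourierCoeff_indicator ha, fourierCoeff_poly, Complex.re_sum]
  congr 1
  refine Finset.sum_congr rfl fun q _ ↦ ?_
  rw [fourierCoeff_zero_pow_loc, ← Complex.ofReal_mul, Complex.ofReal_re]

variable {a : ℚ} {AP Rs : MI}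

/-- Cast of `zeroSumQ`. -/
theorem zeroSumQ_cast (c : ℕ → ℚ) (a : ℚ) {sl : List ℕ} (hsl : sl.Nodup) :
    ((zeroSumQ c a sl : ℚ) : ℝ)
      = ∑ q ∈ sl.toFinset, ((c q : ℚ) : ℝ) * (((a : ℝ) ^ (q + 1) - (-(a : ℝ)) ^ (q + 1)) / (q + 1)) := by
  rw [zeroSumQ, List.sum_toFinset _ hsl, Rat.cast_list_sum, List.map_map]
  congr 1
  refine List.map_congr_left fun q _ ↦ ?_
  simp only [Function.comp_apply]
  push_cast
  ring

/-- ★ **`evenVBox ∋ V⁺(m)`** — the door's printed even profile-table entry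
`(if m = 0 then 1 else 2) · Re ĉ_m(1_{[-a,a]} Σ_{q∈sl} c_q x^q)/√(2a)`. -/
theorem mem_evenVBox (hS : 0 < S) (ha : 0 < a) (hAP : MI.mem S ((a : ℝ) / Real.pi) AP)
    (hRs : MI.mem S (1 / Real.sqrt (2 * (a : ℝ))) Rs) (c : ℕ → ℚ) {sl : List ℕ} (hsl : sl.Nodup) {D : ℕ}
    (hD : ∀ q ∈ sl, q + 1 ≤ D) (m : ℕ) :
    MI.mem S
      ((if m = 0 then (1 : ℝ) else 2) * (Yoshida1992.fourierCoeff (a : ℝ) m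
          ((Icc (-(a : ℝ)) (a : ℝ)).indicator fun x : ℝ ↦
            ∑ q ∈ sl.toFinset, ((((c q : ℚ) : ℝ) : ℝ) : ℂ) * ((x : ℂ)) ^ q)).re / Real.sqrt (2 * (a : ℝ)))
      (evenVBox S AP Rs c a sl D m) := by
  have ha' : (0 : ℝ) < (a : ℝ) := by exact_mod_cast ha
  by_cases hm : m = 0
  · subst hm
    rw [evenVTable_zero_loc ha'.le, evenVBox, if_pos rfl, ← zeroSumQ_cast c a hsl, div_eq_mul_one_div, mul_comm]
    exact mem_mulRatBox hRs _
  · rw [evenVTable_collected ha' hm sl.toFinset (fun q ↦ ((c q : ℚ) : ℝ)) (fun q hq ↦ hD q (List.mem_toFinset.1 hq)),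
      evenVBox, if_neg hm]
    have hsum := mem_sumBox (S := S) (f := fun d ↦ (evenVTabBox S AP Rs c a sl d).divNat (m ^ d))
      (g := fun d ↦ (∑ p ∈ (sl.toFinset.sigma fun q ↦ Finset.range (q + 1)).filter (fun p ↦ p.2 + 1 = d),
          2 * ((c p.1 : ℚ) : ℝ) * ((-1 : ℝ) ^ p.2 * (p.1.descFactorial p.2 : ℝ)
            * ((a : ℝ) ^ (p.1 - p.2) - (-(a : ℝ)) ^ (p.1 - p.2))
            * ((a : ℝ) / π) ^ (p.2 + 1) * (I ^ (p.2 + 1)).re) / Real.sqrt (2 * (a : ℝ))) / (m : ℝ) ^ d)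
      (D + 1) fun d _ ↦ by
        have h1 := MI.mem_divNat (mem_evenVTabBox hS ha hAP hRs c hsl d) (pow_pos (Nat.pos_of_ne_zero hm) d)
        push_cast at h1
        exact h1
    have h2 := MI.mem_mulInt hsum ((-1) ^ m)
    push_cast at h2
    rw [mul_comm] at h2
    exact h2

/-- ★ **`oddVBox ∋ V⁻(k)`** — the door's printed odd profile-table entry `2 · Im ĉ_{k+1}(1_{[-a,a]} Σ_{q∈sl} c_q x^q)/√(2a)`. -/
theorem mem_oddVBox (hS : 0 < S) (ha : 0 < a) (hAP : MI.mem S ((a : ℝ) / Real.pi) AP)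
    (hRs : MI.mem S (1 / Real.sqrt (2 * (a : ℝ))) Rs) (c : ℕ → ℚ) {sl : List ℕ} (hsl : sl.Nodup) {D : ℕ}
    (hD : ∀ q ∈ sl, q + 1 ≤ D) (k : ℕ) :
    MI.mem S
      (2 * (Yoshida1992.fourierCoeff (a : ℝ) ((k : ℤ) + 1)
          ((Icc (-(a : ℝ)) (a : ℝ)).indicator fun x : ℝ ↦
            ∑ q ∈ sl.toFinset, ((((c q : ℚ) : ℝ) : ℝ) : ℂ) * ((x : ℂ)) ^ q)).im / Real.sqrt (2 * (a : ℝ)))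
      (oddVBox S AP Rs c a sl D k) := by
  have ha' : (0 : ℝ) < (a : ℝ) := by exact_mod_cast ha
  have e : ((k : ℤ) + 1) = ((k + 1 : ℕ) : ℤ) := by push_cast; ring
  rw [e, oddVTable_collected ha' (Nat.succ_ne_zero k) sl.toFinset (fun q ↦ ((c q : ℚ) : ℝ))
    (fun q hq ↦ hD q (List.mem_toFinset.1 hq)), oddVBox]
  have hsum := mem_sumBox (S := S) (f := fun d ↦ (oddVTabBox S AP Rs c a sl d).divNat ((k + 1) ^ d))
    (g := fun d ↦ (∑ p ∈ (sl.toFinset.sigma fun q ↦ Finset.range (q + 1)).filter (fun p ↦ p.2 + 1 = d),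
        2 * ((c p.1 : ℚ) : ℝ) * ((-1 : ℝ) ^ p.2 * (p.1.descFactorial p.2 : ℝ)
          * ((a : ℝ) ^ (p.1 - p.2) - (-(a : ℝ)) ^ (p.1 - p.2))
          * ((a : ℝ) / π) ^ (p.2 + 1) * (I ^ (p.2 + 1)).im) / Real.sqrt (2 * (a : ℝ))) / (((k + 1 : ℕ) : ℝ)) ^ d)
    (D + 1) fun d _ ↦ by
      have h1 := MI.mem_divNat (mem_oddVTabBox hS ha hAP hRs c hsl d) (pow_pos (Nat.succ_pos k) d)
      push_cast at h1 ⊢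
      exact h1
  have h2 := MI.mem_mulInt hsum ((-1) ^ (k + 1))
  push_cast at h2 ⊢
  rw [mul_comm] at h2
  exact h2

/-! ## Packed claims of the profile tables -/

/-- **Any evaluator, one full rectangle**: `f i t ∈ box i t` for `i < n`, `t < K` and a passing `Encl.checkRect` give the packed
claim `Encl.DataNear f n K w o c ρ XP`. -/
theorem dataNear_of_checkRect (hS : 0 < S) {f : ℕ → ℕ → ℝ} {box : ℕ → ℕ → MI} {n K w o c ρ : ℕ} {XP : List ℕ}
    (hbox : ∀ i < n, ∀ t < K, MI.mem S (f i t) (box i t))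
    (h : Encl.checkRect S c (ρ : ℤ) w K o box XP 0 n 0 K = true) : Encl.DataNear f n K w o c ρ XP := by
  have h0 : Encl.DataNear f (0 + n) K w o c ρ XP :=
    Encl.DataNear.extendRows Encl.DataNear.zeroRows fun i _ hi t ht ↦ by
      have h2 := Encl.near_of_checkRect hS (f := f)
        (fun i _ hi t _ ht ↦ hbox i (by simpa using hi) t (by simpa using ht)) h (Nat.zero_le i) hi
        (Nat.zero_le t) (by simpa using ht)
      exact_mod_cast h2
  simpa using h0

/-- ★ **Packed claim of the even profile table**, layout `(j, t) ↦ V⁺_j(m₀ + t)` (rows `j < r`, coefficient rows `c j`). -/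
theorem vDataNear_even (hS : 0 < S) (ha : 0 < a) (hAP : MI.mem S ((a : ℝ) / Real.pi) AP)
    (hRs : MI.mem S (1 / Real.sqrt (2 * (a : ℝ))) Rs) (c : ℕ → ℕ → ℚ) {sl : List ℕ} (hsl : sl.Nodup) {D : ℕ}
    (hD : ∀ q ∈ sl, q + 1 ≤ D) (m₀ : ℕ) {r K w o cc ρ : ℕ} {XP : List ℕ}
    (h : Encl.checkRect S cc (ρ : ℤ) w K o (fun j t ↦ evenVBox S AP Rs (c j) a sl D (m₀ + t)) XP 0 r 0 K = true) :
    Encl.DataNear (fun j t ↦ (if m₀ + t = 0 then (1 : ℝ) else 2) * (Yoshida1992.fourierCoeff (a : ℝ) ((m₀ + t : ℕ))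
        ((Icc (-(a : ℝ)) (a : ℝ)).indicator fun x : ℝ ↦
          ∑ q ∈ sl.toFinset, ((((c j q : ℚ) : ℝ) : ℝ) : ℂ) * ((x : ℂ)) ^ q)).re / Real.sqrt (2 * (a : ℝ)))
      r K w o cc ρ XP :=
  dataNear_of_checkRect hS (fun j _ t _ ↦ mem_evenVBox hS ha hAP hRs (c j) hsl hD (m₀ + t)) h

/-- ★ **Packed claim of the even profile table, TRANSPOSED layout** `(t, j) ↦ V⁺_j(m₀ + t)` (rows `t < K`, digits `j < r`). -/
theorem vDataNearT_even (hS : 0 < S) (ha : 0 < a) (hAP : MI.mem S ((a : ℝ) / Real.pi) AP)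
    (hRs : MI.mem S (1 / Real.sqrt (2 * (a : ℝ))) Rs) (c : ℕ → ℕ → ℚ) {sl : List ℕ} (hsl : sl.Nodup) {D : ℕ}
    (hD : ∀ q ∈ sl, q + 1 ≤ D) (m₀ : ℕ) {r K w o cc ρ : ℕ} {XP : List ℕ}
    (h : Encl.checkRect S cc (ρ : ℤ) w r o (fun t j ↦ evenVBox S AP Rs (c j) a sl D (m₀ + t)) XP 0 K 0 r = true) :
    Encl.DataNear (fun t j ↦ (if m₀ + t = 0 then (1 : ℝ) else 2) * (Yoshida1992.fourierCoeff (a : ℝ) ((m₀ + t : ℕ))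
        ((Icc (-(a : ℝ)) (a : ℝ)).indicator fun x : ℝ ↦
          ∑ q ∈ sl.toFinset, ((((c j q : ℚ) : ℝ) : ℝ) : ℂ) * ((x : ℂ)) ^ q)).re / Real.sqrt (2 * (a : ℝ)))
      K r w o cc ρ XP :=
  dataNear_of_checkRect hS (fun t _ j _ ↦ mem_evenVBox hS ha hAP hRs (c j) hsl hD (m₀ + t)) h

/-- ★ **Packed claim of the odd profile table**, layout `(j, t) ↦ V⁻_j(k₀ + t)` (kernel index; mode `k₀ + t + 1`). -/
theorem vDataNear_odd (hS : 0 < S) (ha : 0 < a) (hAP : MI.mem S ((a : ℝ) / Real.pi) AP)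
    (hRs : MI.mem S (1 / Real.sqrt (2 * (a : ℝ))) Rs) (c : ℕ → ℕ → ℚ) {sl : List ℕ} (hsl : sl.Nodup) {D : ℕ}
    (hD : ∀ q ∈ sl, q + 1 ≤ D) (k₀ : ℕ) {r K w o cc ρ : ℕ} {XP : List ℕ}
    (h : Encl.checkRect S cc (ρ : ℤ) w K o (fun j t ↦ oddVBox S AP Rs (c j) a sl D (k₀ + t)) XP 0 r 0 K = true) :
    Encl.DataNear (fun j t ↦ 2 * (Yoshida1992.fourierCoeff (a : ℝ) (((k₀ + t : ℕ) : ℤ) + 1)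
        ((Icc (-(a : ℝ)) (a : ℝ)).indicator fun x : ℝ ↦
          ∑ q ∈ sl.toFinset, ((((c j q : ℚ) : ℝ) : ℝ) : ℂ) * ((x : ℂ)) ^ q)).im / Real.sqrt (2 * (a : ℝ)))
      r K w o cc ρ XP :=
  dataNear_of_checkRect hS (fun j _ t _ ↦ mem_oddVBox hS ha hAP hRs (c j) hsl hD (k₀ + t)) h

/-- ★ **Packed claim of the odd profile table, TRANSPOSED layout** `(t, j) ↦ V⁻_j(k₀ + t)`. -/
theorem vDataNearT_odd (hS : 0 < S) (ha : 0 < a) (hAP : MI.mem S ((a : ℝ) / Real.pi) AP)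
    (hRs : MI.mem S (1 / Real.sqrt (2 * (a : ℝ))) Rs) (c : ℕ → ℕ → ℚ) {sl : List ℕ} (hsl : sl.Nodup) {D : ℕ}
    (hD : ∀ q ∈ sl, q + 1 ≤ D) (k₀ : ℕ) {r K w o cc ρ : ℕ} {XP : List ℕ}
    (h : Encl.checkRect S cc (ρ : ℤ) w r o (fun t j ↦ oddVBox S AP Rs (c j) a sl D (k₀ + t)) XP 0 K 0 r = true) :
    Encl.DataNear (fun t j ↦ 2 * (Yoshida1992.fourierCoeff (a : ℝ) (((k₀ + t : ℕ) : ℤ) + 1)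
        ((Icc (-(a : ℝ)) (a : ℝ)).indicator fun x : ℝ ↦
          ∑ q ∈ sl.toFinset, ((((c j q : ℚ) : ℝ) : ℝ) : ℂ) * ((x : ℂ)) ^ q)).im / Real.sqrt (2 * (a : ℝ)))
      K r w o cc ρ XP :=
  dataNear_of_checkRect hS (fun t _ j _ ↦ mem_oddVBox hS ha hAP hRs (c j) hsl hD (k₀ + t)) h

end CinfPrimV

end Summit.RiemannHypothesis.RiemannHypothesis.Theorems.WeilFormatC
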